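import Literature.Analysis.Complex.JensenPolynomialHyperbolicity
import Literature.NumberTheory.LFunctions.JensenXiFixedDegree
import HarnessLib

/-!
# Hyperbolicity of Jensen polynomials descends in the degree

For any real sequence `γ` and any shift `n`: if `J^{d+1,n}_γ` is hyperbolic then so is `J^{d,n}_γ`.
Indeed the reflected polynomial `X^{d+1} J^{d+1,n}_γ(1/X) = Σ_j (d+1 choose j) γ(n+j) X^{d+1-j}` is
hyperbolic with `J^{d+1,n}_γ`, hence so is its derivative (Rolle), and
`d/dX [X^{d+1} J^{d+1,n}_γ(1/X)] = (d+1) · X^d J^{d,n}_γ(1/X)` (`derivative_reflect_jensenPoly_succ`,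
from `(d+1-j)·(d+1 choose j) = (d+1)·(d choose j)`); reflecting back gives `J^{d,n}_γ`. (The companion
rule `d/dX J^{d+1,n}_γ = (d+1) J^{d,n+1}_γ` is the shift; together these are the classical closure of
the Laguerre–Pólya picture under differentiation, cf. Craven–Csordas 1989 §1–2, GORZ 2019 §1.)

Consequences typed here: `splits_jensenPoly_of_succ`, `…_of_le` (any `d' ≤ d`),
`jensenHyperbolicFrom_of_le`, `jensenHyperbolicBelow_of_le`, `jensenXiAllShifts_of_le` — so an
all-shift theorem at degree `8` for `ξ` gives every degree `d ≤ 8` at once.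

## References
* [CravenCsordas1989] T. Craven, G. Csordas, *Jensen polynomials and the Turán and Laguerre
  inequalities*, Pacific J. Math. 136 (1989), §1 (i), §2 (2.1)–(2.4).
* [GORZPNAS2019] Griffin–Ono–Rolen–Zagier, PNAS 116 (2019), §1.
-/

open Polynomial Finset

namespace Literature.NumberTheory.LFunctions

open Literature.Analysis.Complex.PolyaSchur

/-- Reflecting twice at the same level is the identity. [folklore] -/
private theorem reflect_reflect' (N : ℕ) (f : ℝ[X]) : reflect N (reflect N f) = f := by
  ext i; rw [coeff_reflect, coeff_reflect, revAt_invol]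

/-- `deg (X^d J^{d,n}(1/X)) ≤ d`. [cite: GORZPNAS2019, §1] -/
theorem natDegree_reflect_jensenPoly_le (γ : ℕ → ℝ) (d n : ℕ) :
    (reflect d (jensenPoly γ d n)).natDegree ≤ d := by
  refine natDegree_le_iff_coeff_eq_zero.2 fun i hi => ?_
  have hi' : d < i := by exact_mod_cast hi
  rw [coeff_reflect, revAt, Function.Embedding.coeFn_mk]
  simp only [show ¬ i ≤ d from not_le.2 hi', if_false]
  rw [coeff_jensenPoly, if_neg (not_le.2 hi')]

/-- **The reflection rule:** `d/dX [X^{d+1} J^{d+1,n}_γ(1/X)] = (d+1) · X^d J^{d,n}_γ(1/X)`, i.e.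
`derivative (reflect (d+1) J^{d+1,n}) = (d+1) · reflect d J^{d,n}` — from
`(d+1-j)(d+1 choose j) = (d+1)(d choose j)`. [cite: CravenCsordas1989, §2 eq. (2.1)–(2.4)] -/
theorem derivative_reflect_jensenPoly_succ (γ : ℕ → ℝ) (d n : ℕ) :
    derivative (reflect (d + 1) (jensenPoly γ (d + 1) n)) =
      C ((d : ℝ) + 1) * reflect d (jensenPoly γ d n) := by
  ext i
  rw [coeff_derivative, coeff_reflect, coeff_C_mul, coeff_reflect, coeff_jensenPoly, coeff_jensenPoly]
  by_cases hi : i ≤ d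
  · have h1 : revAt (d + 1) (i + 1) = d - i := by
      rw [revAt_le (by omega)]; omega
    have h2 : revAt d i = d - i := revAt_le hi
    rw [h1, h2, if_pos (by omega), if_pos (Nat.sub_le d i)]
    have hc1 : (d + 1).choose (d - i) = (d + 1).choose (i + 1) := by
      rw [← Nat.choose_symm (show i + 1 ≤ d + 1 by omega)]; congr 1; omega
    have hc2 : d.choose (d - i) = d.choose i := Nat.choose_symm hi
    have hkey : ((d + 1).choose (i + 1) : ℝ) * ((i : ℝ) + 1) = ((d : ℝ) + 1) * (d.choose i : ℝ) := by
      have := Nat.add_one_mul_choose_eq d i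
      have h' : (((d + 1) * d.choose i : ℕ) : ℝ) = (((d + 1).choose (i + 1) * (i + 1) : ℕ) : ℝ) := by
        exact_mod_cast this
      push_cast at h'
      linarith
    rw [hc1, hc2, show n + (d - i) = n + (d - i) from rfl]
    calc ((d + 1).choose (i + 1) : ℝ) * γ (n + (d - i)) * ((i : ℝ) + 1)
        = (((d + 1).choose (i + 1) : ℝ) * ((i : ℝ) + 1)) * γ (n + (d - i)) := by ring
      _ = ((d : ℝ) + 1) * ((d.choose i : ℝ) * γ (n + (d - i))) := by rw [hkey]; ring
  · have hi' : d < i := not_le.1 hi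
    have h1 : revAt (d + 1) (i + 1) = i + 1 := by
      rw [revAt, Function.Embedding.coeFn_mk]; simp only [show ¬ i + 1 ≤ d + 1 by omega, if_false]
    have h2 : revAt d i = i := by
      rw [revAt, Function.Embedding.coeFn_mk]; simp only [hi, if_false]
    rw [h1, h2, if_neg (by omega), if_neg hi]
    simp

/-- **Hyperbolicity descends one degree:** `J^{d+1,n}_γ` hyperbolic ⇒ `J^{d,n}_γ` hyperbolic
(reflect, differentiate, reflect back). [cite: CravenCsordas1989, §1 (i)] -/
theorem splits_jensenPoly_of_succ {γ : ℕ → ℝ} {d n : ℕ} (h : (jensenPoly γ (d + 1) n).Splits) :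
    (jensenPoly γ d n).Splits := by
  have h1 : (reflect (d + 1) (jensenPoly γ (d + 1) n)).Splits :=
    splits_reflect h (natDegree_jensenPoly_le γ (d + 1) n)
  have h2 := splits_derivative h1
  rw [derivative_reflect_jensenPoly_succ] at h2
  have hc : (C ((d : ℝ) + 1) : ℝ[X]) ≠ 0 := C_ne_zero.2 (by positivity)
  have h3 : (reflect d (jensenPoly γ d n)).Splits := (splits_mul_iff_right hc (Splits.C _)).1 h2
  have h4 := splits_reflect h3 (natDegree_reflect_jensenPoly_le γ d n)
  rwa [reflect_reflect'] at h4

/-- **Hyperbolicity descends to every lower degree.** [cite: CravenCsordas1989, §1 (i)] -/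
theorem splits_jensenPoly_of_le {γ : ℕ → ℝ} {d d' n : ℕ} (hd : d' ≤ d)
    (h : (jensenPoly γ d n).Splits) : (jensenPoly γ d' n).Splits := by
  obtain ⟨k, rfl⟩ := Nat.exists_eq_add_of_le hd
  induction k with
  | zero => simpa using h
  | succ k ih =>
    exact ih (by omega) (splits_jensenPoly_of_succ (by rwa [show d' + (k + 1) = d' + k + 1 by omega] at h))

/-- Tails descend: `J^{d,n}_γ` hyperbolic for `n ≥ M` ⇒ `J^{d',n}_γ` hyperbolic for `n ≥ M`, `d' ≤ d`.
[cite: CravenCsordas1989, §1 (i)] -/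
theorem jensenHyperbolicFrom_of_le {γ : ℕ → ℝ} {d d' M : ℕ} (hd : d' ≤ d)
    (h : JensenHyperbolicFrom γ d M) : JensenHyperbolicFrom γ d' M :=
  fun n hn => splits_jensenPoly_of_le hd (h n hn)

/-- Finite ranges descend likewise. [cite: CravenCsordas1989, §1 (i)] -/
theorem jensenHyperbolicBelow_of_le {γ : ℕ → ℝ} {d d' M : ℕ} (hd : d' ≤ d)
    (h : JensenHyperbolicBelow γ d M) : JensenHyperbolicBelow γ d' M :=
  fun n hn => splits_jensenPoly_of_le hd (h n hn)

/-- **All shifts at degree `d` for `ξ` give all shifts at every degree `d' ≤ d`.**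
[cite: CravenCsordas1989, §1 (i)] -/
theorem jensenXiAllShifts_of_le {d d' : ℕ} (hd : d' ≤ d) (h : JensenXiAllShifts d) :
    JensenXiAllShifts d' :=
  fun n => splits_jensenPoly_of_le hd (h n)

end Literature.NumberTheory.LFunctions
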